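import Mathlib
import HarnessLib
import Summits.NavierStokesRegularity.NavierStokesRegularity.Theorems.PoloidalWindowDoorLrcModEntireVerticalDifferenceRow
import Summits.NavierStokesRegularity.NavierStokesRegularity.Theorems.PoloidalWindowDoorPoloidalWindowRigiditySlopeFunctionPressure
import Summits.NavierStokesRegularity.NavierStokesRegularity.Theorems.PoloidalWindowDoorPoloidalWindowRigidityConstantShearSlice
import Summits.NavierStokesRegularity.NavierStokesRegularity.Theorems.PoloidalWindowDoorLrcModEntireTwistingTHFlatRidgeQuarticLawTools

/-!
# Route `PoloidalWindowDoor`, item `LrcModEntire` (stmt-NavierStokesRegularity-20428), cell (Q4-sonic, straight branch), case I, PERIODIC branch —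
# THE DIFFERENCE ROW (E3_D) EXPANDED: transport form with the horizontal Laplacian (P2a of the LEAD picks 20:5xZ; T2B-g17 v10 §9/§10)

Cell ns-regularity-ideate, LEAD-lineage seat ns-poloidal-K2-p3 g17 (`--supports stmt-NavierStokesRegularity-20428`).

`θ := v₂(t,·)`, `a` horizontal, `θᵃ := θ(· + a)`, `ϑ := θᵃ − θ`, `D := v(t,·+a) − v(t,·)`.  From `…VerticalDifferenceRow.verticalResidual_difference` (the two
(TH) weight sources agree), the vertical momentum equation in components (`…SlopeFunctionPressure.material_vert_eq_residual`: `f₂ = θ_t + Dθ[v] − Δθ`) and the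
slab Laplacian split (`…TwistingTHFlatRidgeQuarticLawTools.laplacian_two_eq_rho_mul_horiz_of_plane`: `Δθ = (1−μ)Δₕθ` on the slab, for `v(t,·)` AND for its translate):
* ★ `verticalDifference_law` — at every `x` of the slab,
  `(1−μ)·[(θ_t(x+a) − θ_t(x)) + (Dθ(x+a)[v(x+a)] − Dθ(x)[v(x)]) − (1−μ)(Δₕθ(x+a) − Δₕθ(x))]`
  `= (μ_t − μ_zz)·ϑ + (μ_z/2)(θ(x+a) + θ(x))·ϑ − 2μ_z(∂₂θ(x+a) − ∂₂θ(x))`;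
* `convect_difference_split` — the bilinear split `Dθ(x+a)[v(x+a)] − Dθ(x)[v(x)] = Dϑ(x)[v(x+a)] + Dθ(x)[D(x)]` (pure algebra, `ϑ` differentiable),
so that the row is the template shape `(1−μ)²Δₕϑ = (1−μ)[ϑ_t + Dϑ[vᵃ] + Dθ[D]] − (…)ϑ + 2μ_z∂₂ϑ` — LINEAR in `(ϑ, D)` with coefficients built from `v, vᵃ, θ, μ`; the
shearing (P2b, analogue of port-2 `…ShearedVerticalRow`) turns it into `hR3` of `…SheetSystemMixed.eq_zero_of_mixedSystem_template` for `(ϑ, ⟪e,D⟫, ⟪Je,D⟫)∘Φ`.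

WHAT THIS IS NOT: not a claim about Navier–Stokes regularity and not a stub of the registry; class-level bookkeeping for the residual research cell
`stub_Q4sonicLineNeg` of `Cruxes/LrcModEntire/Lines/twist_split.lean` v13 (bears_on LADDER-NS N0 via item 20428).
-/

noncomputable section

set_option linter.dupNamespace false

namespace Summit.NavierStokesRegularity.NavierStokesRegularity.Theorems.PoloidalWindowDoorLrcModEntireVerticalDifferenceLaw

open Set Function Filter Topology Metric InnerProductSpace
open scoped RealInnerProductSpace InnerProductSpace Laplacian ContDiff
open Literature.Analysis Literature.Analysis.FluidPDE
open Summit.NavierStokesRegularity.NavierStokesRegularity.Theorems.PoloidalWindowDoorPoloidalWindowRigidityWindow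
open Summit.NavierStokesRegularity.NavierStokesRegularity.Theorems.PoloidalWindowDoorPoloidalWindowRigiditySlopeFunctionPressure
open Summit.NavierStokesRegularity.NavierStokesRegularity.Theorems.PoloidalWindowDoorPoloidalWindowRigidityConstantShearSlice
open Summit.NavierStokesRegularity.NavierStokesRegularity.Theorems.PoloidalWindowDoorLrcModEntireTwistingTHFlatRidgeQuarticLawTools
open Summit.NavierStokesRegularity.NavierStokesRegularity.Theorems.PoloidalWindowDoorLrcModEntireVerticalDifferenceRow

variable {C : ℝ} {v : ℝ → EuclideanSpace ℝ (Fin 3) → EuclideanSpace ℝ (Fin 3)}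

/-- **Bilinear split of the convective difference** (pure algebra): `Dθ(y)[w] − Dθ(x)[u] = (Dθ(y) − Dθ(x))[w] + Dθ(x)[w − u]`. -/
theorem convect_difference_split (θ : EuclideanSpace ℝ (Fin 3) → ℝ) (x y u w : EuclideanSpace ℝ (Fin 3)) :
    fderiv ℝ θ y w - fderiv ℝ θ x u = (fderiv ℝ θ y - fderiv ℝ θ x) w + fderiv ℝ θ x (w - u) := by
  simp only [_root_.sub_apply, map_sub]
  ring

section Class

variable (hrate : HasTypeITimeDecay C v) (hcont : ContinuousOn (uncurry v) (Iio (0 : ℝ) ×ˢ univ))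
  (hmild : ∀ s t : ℝ, s < t → t < 0 → ∀ x,
    v t x = UnboundedOperators.heatExtension (v s) (t - s) x - oseenDuhamel 1 s v v t x)
  (hdiv : ∀ t < 0, VectorCalculus.IsDivFree (v t))
include hrate hcont hmild hdiv

/-- **The slab Laplacian split for a class slice:** `Δθ(x) = (1 − μ(t,x₂))·(∂₀²θ + ∂₁²θ)(x)` under the registered slab law (binder form). -/
theorem laplacian_two_slab {μ : ℝ → ℝ → ℝ} {ρ t : ℝ} (ht : t < 0) (htρ : |t + 1| < ρ)
    (hslabU : ∀ t : ℝ, |t + 1| < ρ → ∀ x : EuclideanSpace ℝ (Fin 3), |x 2| < ρ → ∀ b : Fin 3, b ≠ 2 →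
      fderiv ℝ (v t) x (EuclideanSpace.single 2 1) b = μ t (x 2) * fderiv ℝ (v t) x (EuclideanSpace.single b 1) 2)
    {x : EuclideanSpace ℝ (Fin 3)} (hx : |x 2| < ρ) :
    Δ (fun y => v t y 2) x = (1 - μ t (x 2)) *
      (fderiv ℝ (fun x' => fderiv ℝ (fun y' => v t y' 2) x' (EuclideanSpace.single 0 1)) x (EuclideanSpace.single 0 1) +
        fderiv ℝ (fun x' => fderiv ℝ (fun y' => v t y' 2) x' (EuclideanSpace.single 1 1)) x (EuclideanSpace.single 1 1)) := by
  have hA : IsTypeIAncientMild C v := isTypeIAncientMild_of_class hrate hcont hmild hdiv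
  have hs : ContDiff ℝ 2 (v t) := (hA.contDiff_slice ht).of_le (by norm_cast)
  refine laplacian_two_eq_rho_mul_horiz_of_plane (μ₀ := μ t (x 2)) (c := x 2) hs (fun y => div_coord (hdiv t ht) y)
    (fun y hy b hb => ?_) rfl
  have h := hslabU t htρ y (by rw [hy]; exact hx) b hb
  rw [hy] at h
  exact h

/-- ★ **THE DIFFERENCE ROW (E3_D), transport form.**  On the slab, for a horizontal translation `a`, with `θ = v₂(t,·)`:
`(1−μ)·[(θ_t(x+a) − θ_t(x)) + (Dθ(x+a)[v(x+a)] − Dθ(x)[v(x)]) − (1−μ)(Δₕθ(x+a) − Δₕθ(x))]`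
`= (μ_t − μ_zz)(θ(x+a) − θ(x)) + (μ_z/2)(θ(x+a) + θ(x))(θ(x+a) − θ(x)) − 2μ_z(∂₂θ(x+a) − ∂₂θ(x))`. -/
theorem verticalDifference_law
    (hpol : ∀ s < 0, ∀ y, ⟪curl (v s) y, EuclideanSpace.single 2 1⟫_ℝ = 0) {μ : ℝ → ℝ → ℝ}
    (hμ : ContDiff ℝ 3 (uncurry μ)) {ρ t : ℝ} (ht : t < 0) (htρ : |t + 1| < ρ)
    (hslabU : ∀ t : ℝ, |t + 1| < ρ → ∀ x : EuclideanSpace ℝ (Fin 3), |x 2| < ρ → ∀ b : Fin 3, b ≠ 2 →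
      fderiv ℝ (v t) x (EuclideanSpace.single 2 1) b = μ t (x 2) * fderiv ℝ (v t) x (EuclideanSpace.single b 1) 2)
    {x : EuclideanSpace ℝ (Fin 3)} (hx : |x 2| < ρ) {a : EuclideanSpace ℝ (Fin 3)} (ha : a 2 = 0) :
    (1 - μ t (x 2)) *
        ((deriv (fun s => v s (x + a) 2) t - deriv (fun s => v s x 2) t)
          + (fderiv ℝ (fun y => v t y 2) (x + a) (v t (x + a)) - fderiv ℝ (fun y => v t y 2) x (v t x))
          - (1 - μ t (x 2)) *
            ((fderiv ℝ (fun x' => fderiv ℝ (fun y' => v t y' 2) x' (EuclideanSpace.single 0 1)) (x + a) (EuclideanSpace.single 0 1) +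
                fderiv ℝ (fun x' => fderiv ℝ (fun y' => v t y' 2) x' (EuclideanSpace.single 1 1)) (x + a) (EuclideanSpace.single 1 1))
              - (fderiv ℝ (fun x' => fderiv ℝ (fun y' => v t y' 2) x' (EuclideanSpace.single 0 1)) x (EuclideanSpace.single 0 1) +
                fderiv ℝ (fun x' => fderiv ℝ (fun y' => v t y' 2) x' (EuclideanSpace.single 1 1)) x (EuclideanSpace.single 1 1)))) =
      (deriv (fun s => μ s (x 2)) t - deriv (deriv (μ t)) (x 2)) * (v t (x + a) 2 - v t x 2)
        + deriv (μ t) (x 2) / 2 * (v t (x + a) 2 + v t x 2) * (v t (x + a) 2 - v t x 2)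
        - 2 * deriv (μ t) (x 2) * (fderiv ℝ (v t) (x + a) (EuclideanSpace.single 2 1) 2 - fderiv ℝ (v t) x (EuclideanSpace.single 2 1) 2) := by
  -- the slab law in the `eventually` form near every slab point at time `t`
  have hslab : ∀ y : EuclideanSpace ℝ (Fin 3), |y 2| < ρ → ∀ᶠ z in 𝓝 ((t, y) : ℝ × EuclideanSpace ℝ (Fin 3)), ∀ b : Fin 3, b ≠ 2 →
      fderiv ℝ (v z.1) z.2 (EuclideanSpace.single 2 1) b = μ z.1 (z.2 2) * fderiv ℝ (v z.1) z.2 (EuclideanSpace.single b 1) 2 := by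
    intro y hy
    have hopen : IsOpen {z : ℝ × EuclideanSpace ℝ (Fin 3) | |z.1 + 1| < ρ ∧ |z.2 2| < ρ} := by
      refine IsOpen.and ?_ ?_
      · exact isOpen_lt (continuous_abs.comp (continuous_fst.add continuous_const)) continuous_const
      · exact isOpen_lt (continuous_abs.comp ((EuclideanSpace.proj (2 : Fin 3)).continuous.comp continuous_snd)) continuous_const
    filter_upwards [hopen.mem_nhds (show ((t, y) : ℝ × EuclideanSpace ℝ (Fin 3)) ∈ {z : ℝ × EuclideanSpace ℝ (Fin 3) | |z.1 + 1| < ρ ∧ |z.2 2| < ρ}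
      from ⟨htρ, hy⟩)] with z hz b hb
    exact hslabU z.1 hz.1 z.2 hz.2 b hb
  have hrow := verticalResidual_difference hrate hcont hmild hdiv hpol hμ ht hslab hx ha
  have hxa : (x + a) 2 = x 2 := by simp [ha]
  have hxa' : |(x + a) 2| < ρ := by rw [hxa]; exact hx
  -- residual components and Laplacian splits at `x` and `x + a`
  have hRx := material_vert_eq_residual hrate hcont hmild hdiv ht x
  have hRa := material_vert_eq_residual hrate hcont hmild hdiv ht (x + a)
  have hLx := laplacian_two_slab hrate hcont hmild hdiv ht htρ hslabU hx
  have hLa := laplacian_two_slab hrate hcont hmild hdiv ht htρ hslabU hxa'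
  rw [hxa] at hLa
  rw [← hRx, ← hRa, hLx, hLa] at hrow
  linear_combination hrow

end Class

end Summit.NavierStokesRegularity.NavierStokesRegularity.Theorems.PoloidalWindowDoorLrcModEntireVerticalDifferenceLaw

end
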